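import Literature.AlgebraicGeometry.HodgeTheory.TimesNonCMCurveInvariance
import Literature.AlgebraicGeometry.HodgeTheory.NoTypeIVTimesCMProductSpan
import Literature.AlgebraicGeometry.HodgeTheory.AbelianThreefoldsStablyNondegenerate
import Literature.AlgebraicGeometry.HodgeTheory.FiniteProductsMixedPowersRetract
import Literature.AlgebraicGeometry.HodgeTheory.EllipticCurvesCMTypeProductsHodgeConjecture
import Literature.AlgebraicGeometry.Motives.AbelianVarietyKernelComponent
import Literature.AlgebraicGeometry.Motives.AbelianVarietyIsogenyCancellation
import HarnessLib

/-!
# `HodgeClassesProductSpan (A^{N+1}) (E^{N+1})` and condition (D) for `A × E`, `E` an elliptic curve without complex multiplication with `Hom(A, E) = 0` (Moonen–Zarhin 1999 Lemma (3.4) with (3.1)); EVERY abelian fourfold `T × E` with `E` non-CM satisfies (D) (Thm. 0.1 (4))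

Family `hodge`, layer `Literature/AlgebraicGeometry/HodgeTheory`. Research context: cell `pub-hodge-ring2`
(HONEST FRAMING: research route conditional on HC_CM; not a corollary; Q11.4-sentence-2 already refuted in
dim ≥ 3), Literature lane, programme R22 («`X × E` for a NON-CM elliptic curve `E` and ANY `X` with
`Hom(X, E) = 0`»). UNCONDITIONAL; theorems only, no definition, no named fact; no step towards a summit statement
beyond the published theorems it formalizes. This file is the COMPANION of `NoTypeIVTimesCMProductSpan`
(programme R5) fed by the invariance theorem `AVSlots.exists_coeff_eq_zero_off_balanced_of_prod_nonCMCurve`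
(`TimesNonCMCurveInvariance`), and of the rows of `CMCurveTimesSimpleCMVarietyDichotomy` /
`AbelianThreefoldsStablyNondegenerate` (programmes R19–R21) for an elliptic factor WITHOUT complex multiplication.

PRINTED RESULTS. B. Moonen, Yu. G. Zarhin, Math. Ann. **315** (1999) 711–733 [corpus: paper:arxiv-math_9901113
pp. 6–7]. §3 (3.1): `Hg(X₁ × X₂) = Hg(X₁) × Hg(X₂)` fails «if and only if for some `m` and `n` the Hodge ring
`B(X₁^m × X₂^n)` is not generated by the elements coming from `B(X₁^m)` and `B(X₂^n)`»; Lemma (3.4): «… Then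
either `Hg(X) = Hg(X₁) × Hg(X₂)` or `Hom(X₂, X₁) ≠ 0`», for `X₂ = E` an elliptic curve with `End⁰(E) = ℚ`
(Remark (3.5), Prop. (3.8): «If `End⁰(E) = ℚ` then we apply Lemma (3.4)»); Thm. (3.2)/§3 first paragraph: if both
factors satisfy condition (D) (`B• = D•` on all powers) and `Hg` splits, the product satisfies (D); Thm. 0.1:
«Let `X` be a complex abelian variety with `dim(X) ≤ 5`» — (D) holds outside the listed exceptional cases; in
dimension 4 none of them has a NON-CM elliptic isogeny factor (case (a) `X ∼ E_k × T` needs `E_k` of CM type,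
cases (b)–(d) are simple fourfolds) [corpus: paper:arxiv-math_9901113 p. 1 L77–L117].

MAIN RESULTS (all proved):
* `hodgeClassesProductSpan_of_avSlots_of_nonCMCurve`: for `B` with `n` slots over `A` and `Z` with `n` slots over
  `E` (`dim E = 1`, `finrank_ℚ End⁰(E) = 1`, no non-zero morphism of Hodge structures `H¹(E) → H¹(A)`), every
  rational `(p,p)`-class on `B × Z` is a `ℂ`-combination of exterior products of RATIONAL HODGE classes — in
  particular `HodgeClassesProductSpan (A^{N+1}) (E^{N+1})` for all `N`
  (`hodgeClassesProductSpan_powSucc_powSucc_of_nonCMCurve`, `…_of_forall_hom_eq_zero` with «`Hom(A, E) = 0`»);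
* `IsStablyNondegenerate.prod_nonCMCurve_of_forall_hom_eq_zero`: if `A` satisfies condition (D), so does
  `A × E` (and `E × A`, and all `A^{a+1} × E^{b+1}`);
* THE FOURFOLD ROW `isStablyNondegenerate_prod_nonCMCurve_of_dim_le_three`: for EVERY abelian variety `T` of
  dimension `≤ 3` (all of which satisfy (D): `isStablyNondegenerate_of_dim_pos_of_dim_le_three`, programmes
  R19–R21) and every non-CM elliptic curve `E` with `Hom(T, E) = 0`, `T × E` satisfies (D); hence the Hodge
  conjecture for all powers `(T × E)^{N+1}` and everything isogenous to them
  (`hodgeConjectureFor_powSucc_prod_nonCMCurve_of_dim_le_three`, `…_of_isIsogenous_…`) — UNCONDITIONALLY;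
* THE FOURFOLD THEOREM `isStablyNondegenerate_threefold_prod_nonCMCurve (hT3 : T.dim = 3) (hE1 : E.dim = 1)
  (hEend : finrank_ℚ End⁰(E) = 1) : IsStablyNondegenerate (T.prod E)` — NO `Hom` hypothesis: for EVERY complex
  abelian threefold `T` and every elliptic curve `E` without complex multiplication, `T × E` and everything isogenous
  to it satisfy (D), so the Hodge conjecture holds for all their powers
  (`hodgeConjectureFor_powSucc_of_isIsogenous_threefold_prod_nonCMCurve`), UNCONDITIONALLY — Moonen–Zarhin's
  Thm. 0.1 (4) for all fourfolds with a non-CM elliptic isogeny factor (Poincaré case analysis: `T` simple /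
  `T ∼ E' × S` with `S` simple or not, `E' ∼ E` or `Hom(E', E) = 0`);
* the complementary shapes `E^{a+1} × S^{b+1}`, `E^{a+1} × E'^{b+1}` (`Hom(T, E) ≠ 0`: `T ∼ E × S`, …) are (D) for
  EVERY elliptic curve `E` (`isStablyNondegenerate_powSucc_prod_powSucc_of_dim_add_le_three`: mixed powers of two
  factors of total dimension `≤ 3`, from the threefold theorem and the mixed-powers retract).

PROOF. §3 (the fourfold theorem) is a case analysis on Poincaré decompositions
(`exists_curve_prod_surface_isIsogenous_of_not_isSimple_threefold`, `exists_curve_prod_curve_isIsogenous_of_not_isSimple_surface`),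
«a non-zero homomorphism between simple abelian varieties is an isogeny» (`isIsogeny_of_isSimple_of_ne_zero`, so
homomorphisms between simple varieties of different dimensions vanish and homomorphisms out of `E' × S` split), the
`Hom = 0` row of §2, the multi-curve slots of `EllipticCurvesProductsStablyNondegenerate` (four curves) and isogeny
transport (`isIsogenous_prodRotate`, `IsIsogenous.prod`, `IsStablyNondegenerate.of_isIsogenous`). §1 = the companion's §2 verbatim (evaluation into typed cup products,
`wordEval_mem_span_typed_cup_pureType_of_eq_zero_off_balanced`, and the typed Künneth criterion
`mem_span_hodgeProductClasses_of_mem_span_pureType`) fed by the new invariance theorem; §2 the (D) rows from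
`isStablyNondegenerate_prod_of_forall_productSpan_powSucc` (Moonen–Zarhin §3 glue), `EllipticCurve.isStablyNondegenerate`,
`IsStablyNondegenerate.powSucc_prod_powSucc`, `IsStablyNondegenerate.of_isIsogenous` and the threefold theorem.

## References

* [MoonenZarhin1999LowDim] B. Moonen, Yu. Zarhin, Math. Ann. 315 (1999), Thm. 0.1, §3 (3.1), Thm. (3.2),
  Lemma (3.4), Remark (3.5), Prop. (3.8). [cite: MoonenZarhin1999LowDim, §3 Lemma (3.4)]
* [Gordon1999HodgeAVSurvey] B. B. Gordon, *A survey of the Hodge conjecture for abelian varieties*, Thm. 7.5,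
  Def. 7.6, Thm. 7.6.2. [cite: Gordon1999HodgeAVSurvey, Def. 7.6]
* [vanGeemen1994HodgeAV] B. van Geemen, *An introduction to the Hodge conjecture for abelian varieties* (1994),
  §2.4, §3.6–3.7, Thm. 4.3. [cite: vanGeemen1994HodgeAV, §3.6 (p. 236)]
* [DeligneMilne1982Tannakian] P. Deligne, J. S. Milne, LNM 900 (1982), §6 Thm. 6.20. [cite: DeligneMilne1982Tannakian, §6 Thm. 6.20]
* [MumfordAV1970] D. Mumford, *Abelian Varieties* (1970), §19 Thm. 1 (Poincaré's complete reducibility) and Cor. 2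
  (pp. 173–174). [cite: MumfordAV1970, §19 Thm. 1 (pp. 173–174)]
* [HatcherAT2002] A. Hatcher, *Algebraic Topology* (2002), §3.2 Thm. 3.16. [cite: HatcherAT2002, §3.2 Thm. 3.16]
* [VoisinHodgeI2002] C. Voisin, *Hodge Theory I*, §11.3.2 Thm. 11.38. [cite: VoisinHodgeI2002, §11.3.2 Thm. 11.38]
-/

noncomputable section

open scoped TensorProduct
open CategoryTheory CategoryTheory.Limits Module MonoidalCategory CartesianMonoidalCategory

namespace Literature.AlgebraicGeometry.HodgeTheory

open Literature.AlgebraicTopology.SingularHomology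
open Literature.AlgebraicGeometry.Motives (IsSmoothProjective AbelianVariety bettiCohomology
  ofRatClassBaseChange ComplexPoints)
open Literature.AlgebraicGeometry.Motives.AbelianVariety
open Literature.Barriers.HodgeConjecture
open Literature.RepresentationTheory.GeneralLinear

/-! ### §1 `HodgeClassesProductSpan B Z` for slots over `A` and over a non-CM elliptic curve `E` with `Hom_Hdg = 0` -/

section ProductSpan

variable {A B E Z : AbelianVariety ℂ} {n : ℕ} {gB : Fin n → (B ⟶ A)} {gE : Fin n → (Z ⟶ E)}

/-- **`HodgeClassesProductSpan B Z` (Moonen–Zarhin Lemma (3.4) with (3.1) for «anything × non-CM elliptic curve,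
`Hom = 0`», PROVED with slots).** Let `E` be an elliptic curve with `finrank_ℚ End⁰(E) = 1`, let no non-zero
`H¹(E(ℂ); ℚ) → H¹(A(ℂ); ℚ)` be a morphism of Hodge structures, let `B` have `n` slots over `A` and `Z` have `n`
slots over `E` (e.g. `B = A^{N+1}`, `Z = E^{N+1}`). Then every rational class of Hodge type `(p,p)` on `B × Z` is a
`ℂ`-combination of exterior products `pr_B^* a ⌣ pr_Z^* b` of RATIONAL HODGE classes `a` of `B` and `b` of `Z`.
[cite: MoonenZarhin1999LowDim, §3 (3.1) and Lemma (3.4)] [cite: VoisinHodgeI2002, §11.3.2 Thm. 11.38] -/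
theorem hodgeClassesProductSpan_of_avSlots_of_nonCMCurve (hE1 : E.dim = 1)
    (hEend : Module.finrank ℚ E.endAlgebra = 1)
    (hHom : ∀ ψ : bettiCohomology E.X 1 →ₗ[ℚ] bettiCohomology A.X 1, IsHodgeMorphismOne A E ψ → ψ = 0)
    (hgB : AVSlots A B gB) (hgE : AVSlots E Z gE) :
    HodgeClassesProductSpan B Z := by
  classical
  intro p c hcQ hc
  have hB : IsSmoothProjective B.dim B.X := Motives.AbelianVariety.isSmoothProjective_holds
  have hZ : IsSmoothProjective Z.dim Z.X := Motives.AbelianVariety.isSmoothProjective_holds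
  have hXA : IsSmoothProjective A.dim A.X := Motives.AbelianVariety.isSmoothProjective_holds
  have hXE : IsSmoothProjective E.dim E.X := Motives.AbelianVariety.isSmoothProjective_holds
  obtain ⟨hA, bA, h, cE, hbA0, hbA1, hcE0, hcE1, hmain⟩ :=
    (hgB.prodLift hgE).exists_coeff_eq_zero_off_balanced_of_prod_nonCMCurve hE1 hEend hHom
  have hc' : IsOfHodgeType (B.prod Z).dim (B.prod Z).X (2 * p) p p c := by
    rw [Motives.AbelianVariety.dim_prod]; exact hc
  rcases Nat.eq_zero_or_pos p with rfl | hp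
  · -- degree `0`: `c = s · 1 = pr_B^*(s · 1_B) ⌣ pr_Z^* 1_Z`
    have h1 : c ∈ Submodule.span ℂ {singularCohomology.one ℂ (ComplexPoints (B.X ⊗ Z.X))} :=
      mem_divisorClassesSpan_zero (N := B.dim + Z.dim) (IsSmoothProjective.tensor_holds hB hZ) c
    obtain ⟨s, hs⟩ := Submodule.mem_span_singleton.1 h1
    refine mem_span_hodgeProductClasses_of_mem_span_pureType B Z hcQ hc (Submodule.subset_span ?_)
    refine ⟨0, 0, rfl, s • singularCohomology.one ℂ (ComplexPoints B.X), singularCohomology.one ℂ (ComplexPoints Z.X),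
      ⟨0, rfl, isOfHodgeType_zero_zero_of_degree_zero hB _⟩,
      ⟨0, 0, rfl, isOfHodgeType_zero_zero_of_degree_zero hZ _⟩, ?_⟩
    rw [← hs, map_smul, LinearMap.map_smul₂]
    erw [singularCohomology.map_one, singularCohomology.map_one, cupProduct_one]
  · obtain ⟨a, hca, hkill⟩ := hmain hp hcQ hc'
    -- the letters of `B × Z` over `A × E` are `pr_B^*`(letters of `B` over `A`) and `pr_Z^*`(letters of `Z` over `E`)
    set xA : (Fin n × Fin hA) × Fin 2 → complexBetti B.X 1 := fun jr =>
      complexBetti.map (gB jr.1.1).hom.hom.hom 1 (ofRatClassBaseChange (ComplexPoints A.X) 1 (bA (jr.1.2, jr.2)))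
      with hxA
    set y : (Fin n × Fin h) × Fin 2 → complexBetti Z.X 1 := fun jr =>
      complexBetti.map (gE jr.1.1).hom.hom.hom 1 (ofRatClassBaseChange (ComplexPoints E.X) 1 (cE (jr.1.2, jr.2)))
      with hy
    have hletters : (fun jr : (Fin n × (Fin hA ⊕ Fin h)) × Fin 2 => complexBetti.map
        (Motives.AbelianVariety.prodLift (Motives.AbelianVariety.fst B Z ≫ gB jr.1.1)
          (Motives.AbelianVariety.snd B Z ≫ gE jr.1.1)).hom.hom.hom 1
        (Sum.elim
          (fun i => complexBetti.map (Motives.AbelianVariety.fst A E).hom.hom.hom 1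
            (ofRatClassBaseChange (ComplexPoints A.X) 1 (bA (i, jr.2))))
          (fun i => complexBetti.map (Motives.AbelianVariety.snd A E).hom.hom.hom 1
            (ofRatClassBaseChange (ComplexPoints E.X) 1 (cE (i, jr.2))))
          jr.1.2)) =
        fun jr : (Fin n × (Fin hA ⊕ Fin h)) × Fin 2 => Sum.elim
          (fun i => complexBetti.map (Motives.AbelianVariety.fst B Z).hom.hom.hom 1 (xA ((jr.1.1, i), jr.2)))
          (fun i => complexBetti.map (Motives.AbelianVariety.snd B Z).hom.hom.hom 1 (y ((jr.1.1, i), jr.2)))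
          jr.1.2 := by
      funext jr
      obtain ⟨⟨j, t⟩, κ⟩ := jr
      rcases t with i | i
      · simp only [Sum.elim_inl, hxA]
        rw [complexBetti_map_map_hom, complexBetti_map_map_hom, Motives.AbelianVariety.prodLift_fst]
      · simp only [Sum.elim_inr, hy]
        rw [complexBetti_map_map_hom, complexBetti_map_map_hom, Motives.AbelianVariety.prodLift_snd]
    -- types of the letters
    have hxA0 : ∀ jr : (Fin n × Fin hA) × Fin 2, jr.2 = 0 → IsOfHodgeType B.dim B.X 1 1 0 (xA jr) := by
      rintro ⟨⟨j, i⟩, κ⟩ hκ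
      change κ = 0 at hκ
      subst hκ
      exact (hbA0 i).map_of_isSmoothProjective hB hXA _
    have hxA1 : ∀ jr : (Fin n × Fin hA) × Fin 2, jr.2 = 1 → IsOfHodgeType B.dim B.X 1 0 1 (xA jr) := by
      rintro ⟨⟨j, i⟩, κ⟩ hκ
      change κ = 1 at hκ
      subst hκ
      exact (hbA1 i).map_of_isSmoothProjective hB hXA _
    have hy0 : ∀ jr : (Fin n × Fin h) × Fin 2, jr.2 = 0 → IsOfHodgeType Z.dim Z.X 1 1 0 (y jr) := by
      rintro ⟨⟨j, i⟩, κ⟩ hκ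
      change κ = 0 at hκ
      subst hκ
      exact (hcE0 i).map_of_isSmoothProjective hZ hXE _
    have hy1 : ∀ jr : (Fin n × Fin h) × Fin 2, jr.2 = 1 → IsOfHodgeType Z.dim Z.X 1 0 1 (y jr) := by
      rintro ⟨⟨j, i⟩, κ⟩ hκ
      change κ = 1 at hκ
      subst hκ
      exact (hcE1 i).map_of_isSmoothProjective hZ hXE _
    -- evaluate and feed the typed criterion
    have hmem := wordEval_mem_span_typed_cup_pureType_of_eq_zero_off_balanced
      (Motives.AbelianVariety.fst B Z) (Motives.AbelianVariety.snd B Z) xA y hxA0 hxA1 hy0 hy1 hkill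
    rw [← hletters, hca] at hmem
    refine mem_span_hodgeProductClasses_of_mem_span_pureType B Z hcQ hc (Submodule.span_mono ?_ hmem)
    rintro z ⟨i, j, hij, d, μ, hd, hμ, rfl⟩
    exact ⟨i, j, hij, d, μ, hd, hμ, rfl⟩


/-- **`HodgeClassesProductSpan A E`** for `E` a non-CM elliptic curve and `Hom_Hdg(H¹(E), H¹(A)) = 0` (one slot
on each side). [cite: MoonenZarhin1999LowDim, §3 (3.1) and Lemma (3.4)] -/
theorem hodgeClassesProductSpan_of_nonCMCurve (hE1 : E.dim = 1) (hEend : Module.finrank ℚ E.endAlgebra = 1)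
    (hHom : ∀ ψ : bettiCohomology E.X 1 →ₗ[ℚ] bettiCohomology A.X 1, IsHodgeMorphismOne A E ψ → ψ = 0) :
    HodgeClassesProductSpan A E :=
  hodgeClassesProductSpan_of_avSlots_of_nonCMCurve hE1 hEend hHom (avSlots_self A) (avSlots_self E)

/-- **All equal powers: `HodgeClassesProductSpan (A^{N+1}) (E^{N+1})`** (slots `avPowSlots` on both sides) —
Moonen–Zarhin (3.1) for `m = n`: the Hodge ring of `A^{N+1} × E^{N+1}` is generated by the classes coming from the
two factors. [cite: MoonenZarhin1999LowDim, §3 (3.1) and Lemma (3.4)] -/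
theorem hodgeClassesProductSpan_powSucc_powSucc_of_nonCMCurve (hE1 : E.dim = 1)
    (hEend : Module.finrank ℚ E.endAlgebra = 1)
    (hHom : ∀ ψ : bettiCohomology E.X 1 →ₗ[ℚ] bettiCohomology A.X 1, IsHodgeMorphismOne A E ψ → ψ = 0) (N : ℕ) :
    HodgeClassesProductSpan (A.powSucc N) (E.powSucc N) :=
  hodgeClassesProductSpan_of_avSlots_of_nonCMCurve hE1 hEend hHom (AVSlots.powSucc A N) (AVSlots.powSucc E N)

/-- **Geometric form: `Hom(A, E) = 0` ⟹ `HodgeClassesProductSpan (A^{N+1}) (E^{N+1})`** for a non-CM elliptic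
curve `E` (Riemann / Deligne–Milne 6.20 turns `Hom(A, E) = 0` into `Hom_Hdg(H¹(E), H¹(A)) = 0`).
[cite: MoonenZarhin1999LowDim, §3 (3.1), Lemma (3.4) and Prop. (3.8)] [cite: DeligneMilne1982Tannakian, §6 Thm. 6.20] -/
theorem hodgeClassesProductSpan_powSucc_powSucc_of_nonCMCurve_of_forall_hom_eq_zero (hE1 : E.dim = 1)
    (hEend : Module.finrank ℚ E.endAlgebra = 1) (hAE : ∀ u : A ⟶ E, u = 0) (N : ℕ) :
    HodgeClassesProductSpan (A.powSucc N) (E.powSucc N) :=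
  hodgeClassesProductSpan_powSucc_powSucc_of_nonCMCurve hE1 hEend
    (forall_isHodgeMorphismOne_eq_zero_of_forall_hom_eq_zero hAE) N

/-- `HodgeClassesProductSpan A E` from `Hom(A, E) = 0`, `E` a non-CM elliptic curve.
[cite: MoonenZarhin1999LowDim, §3 (3.1), Lemma (3.4) and Prop. (3.8)] -/
theorem hodgeClassesProductSpan_of_nonCMCurve_of_forall_hom_eq_zero (hE1 : E.dim = 1)
    (hEend : Module.finrank ℚ E.endAlgebra = 1) (hAE : ∀ u : A ⟶ E, u = 0) : HodgeClassesProductSpan A E :=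
  hodgeClassesProductSpan_of_nonCMCurve hE1 hEend (forall_isHodgeMorphismOne_eq_zero_of_forall_hom_eq_zero hAE)

end ProductSpan

/-! ### §2 Condition (D) for `A × E` and the fourfold row `T × E` -/

section StablyNondegenerate

variable {A E T S : AbelianVariety ℂ}

/-- **If `A` satisfies condition (D), `E` is a non-CM elliptic curve and `Hom(A, E) = 0`, then `A × E` satisfies
condition (D)** («`Hg(X × E) = Hg(X) × Hg(E)`», Moonen–Zarhin Lemma (3.4), and the §3 glue: product span on all
equal powers + (D) for both factors ⟹ (D) for the product; an elliptic curve is (D)).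
[cite: MoonenZarhin1999LowDim, §3 (3.1), Thm. (3.2), Lemma (3.4) and Prop. (3.8)] [cite: Gordon1999HodgeAVSurvey, Def. 7.6] -/
theorem IsStablyNondegenerate.prod_nonCMCurve_of_forall_hom_eq_zero (hA : IsStablyNondegenerate A)
    (hE1 : E.dim = 1) (hEend : Module.finrank ℚ E.endAlgebra = 1) (hAE : ∀ u : A ⟶ E, u = 0) :
    IsStablyNondegenerate (A.prod E) :=
  isStablyNondegenerate_prod_of_forall_productSpan_powSucc A E
    (fun N => hodgeClassesProductSpan_powSucc_powSucc_of_nonCMCurve_of_forall_hom_eq_zero hE1 hEend hAE N) hA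
    (EllipticCurve.isStablyNondegenerate hE1)

/-- The same with the factors in the order `E × A`. [cite: MoonenZarhin1999LowDim, §3 Thm. (3.2) and Lemma (3.4)] -/
theorem IsStablyNondegenerate.nonCMCurve_prod_of_forall_hom_eq_zero (hA : IsStablyNondegenerate A)
    (hE1 : E.dim = 1) (hEend : Module.finrank ℚ E.endAlgebra = 1) (hAE : ∀ u : A ⟶ E, u = 0) :
    IsStablyNondegenerate (E.prod A) :=
  isStablyNondegenerate_prod_of_forall_productSpan_powSucc E A
    (fun N => (hodgeClassesProductSpan_powSucc_powSucc_of_nonCMCurve_of_forall_hom_eq_zero hE1 hEend hAE N).symm)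
    (EllipticCurve.isStablyNondegenerate hE1) hA

/-- All mixed powers `A^{a+1} × E^{b+1}` are then stably nondegenerate.
[cite: MoonenZarhin1999LowDim, §3 Thm. (3.2)] [cite: vanGeemen1994HodgeAV, §3.6 (p. 236)] -/
theorem IsStablyNondegenerate.powSucc_prod_nonCMCurve_powSucc_of_forall_hom_eq_zero (hA : IsStablyNondegenerate A)
    (hE1 : E.dim = 1) (hEend : Module.finrank ℚ E.endAlgebra = 1) (hAE : ∀ u : A ⟶ E, u = 0) (a b : ℕ) :
    IsStablyNondegenerate ((A.powSucc a).prod (E.powSucc b)) :=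
  (hA.prod_nonCMCurve_of_forall_hom_eq_zero hE1 hEend hAE).powSucc_prod_powSucc a b

/-- **THE FOURFOLD ROW (Moonen–Zarhin Thm. 0.1 for `X = T × E`, `E` without complex multiplication, `Hom(T, E) = 0`):
for EVERY complex abelian variety `T` with `0 < dim T ≤ 3` and every elliptic curve `E` with `End⁰(E) = ℚ` and
`Hom(T, E) = 0`, `T × E` is stably nondegenerate** (`B• = D•` on all powers) — `T` is (D) by the dimension-`≤ 3`
theorem (`isStablyNondegenerate_of_dim_pos_of_dim_le_three`), and the previous theorem.
[cite: MoonenZarhin1999LowDim, Thm. 0.1 (4), Lemma (3.4) and Prop. (3.8)] [cite: vanGeemen1994HodgeAV, Thm. 4.3] -/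
theorem isStablyNondegenerate_prod_nonCMCurve_of_dim_le_three (h0 : 0 < T.dim) (h3 : T.dim ≤ 3)
    (hE1 : E.dim = 1) (hEend : Module.finrank ℚ E.endAlgebra = 1) (hTE : ∀ u : T ⟶ E, u = 0) :
    IsStablyNondegenerate (T.prod E) :=
  (isStablyNondegenerate_of_dim_pos_of_dim_le_three h0 h3).prod_nonCMCurve_of_forall_hom_eq_zero hE1 hEend hTE

/-- **The Hodge conjecture for every power `(T × E)^{N+1}`**, `dim T ≤ 3`, `E` a non-CM elliptic curve,
`Hom(T, E) = 0` — UNCONDITIONALLY. [cite: MoonenZarhin1999LowDim, Thm. 0.1 (4) and Lemma (3.4)]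
[cite: vanGeemen1994HodgeAV, §2.4 and Lemma 3.7] -/
theorem hodgeConjectureFor_powSucc_prod_nonCMCurve_of_dim_le_three (h0 : 0 < T.dim) (h3 : T.dim ≤ 3)
    (hE1 : E.dim = 1) (hEend : Module.finrank ℚ E.endAlgebra = 1) (hTE : ∀ u : T ⟶ E, u = 0) (N : ℕ) :
    HodgeConjectureFor ((T.prod E).powSucc N).dim ((T.prod E).powSucc N).X :=
  (isStablyNondegenerate_prod_nonCMCurve_of_dim_le_three h0 h3 hE1 hEend hTE).hodgeConjectureFor_powSucc N

/-- **The Hodge conjecture for `T × E` itself** (`N = 0`; for `dim T = 3` an abelian FOURFOLD).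
[cite: MoonenZarhin1999LowDim, Thm. 0.1 (4) and Lemma (3.4)] -/
theorem hodgeConjectureFor_prod_nonCMCurve_of_dim_le_three (h0 : 0 < T.dim) (h3 : T.dim ≤ 3)
    (hE1 : E.dim = 1) (hEend : Module.finrank ℚ E.endAlgebra = 1) (hTE : ∀ u : T ⟶ E, u = 0) :
    HodgeConjectureFor (T.prod E).dim (T.prod E).X :=
  (isStablyNondegenerate_prod_nonCMCurve_of_dim_le_three h0 h3 hE1 hEend hTE).hodgeConjectureFor

/-- **The Hodge conjecture for everything isogenous to a power of `T × E`** (van Geemen Lemma 3.7).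
[cite: MoonenZarhin1999LowDim, Thm. 0.1 (4)] [cite: vanGeemen1994HodgeAV, Lemma 3.7] -/
theorem hodgeConjectureFor_of_isIsogenous_powSucc_prod_nonCMCurve_of_dim_le_three (h0 : 0 < T.dim)
    (h3 : T.dim ≤ 3) (hE1 : E.dim = 1) (hEend : Module.finrank ℚ E.endAlgebra = 1) (hTE : ∀ u : T ⟶ E, u = 0)
    {Y : AbelianVariety ℂ} {N : ℕ} (hY : AbelianVariety.IsIsogenous Y ((T.prod E).powSucc N)) :
    HodgeConjectureFor Y.dim Y.X :=
  (isStablyNondegenerate_prod_nonCMCurve_of_dim_le_three h0 h3 hE1 hEend hTE).hodgeConjectureFor_of_isIsogenous_powSucc hY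

/-- Stable nondegeneracy of everything isogenous to `T × E`. [cite: MoonenZarhin1999LowDim, Thm. 0.1 (4)]
[cite: vanGeemen1994HodgeAV, §3.6 (p. 236)] -/
theorem isStablyNondegenerate_of_isIsogenous_prod_nonCMCurve_of_dim_le_three (h0 : 0 < T.dim) (h3 : T.dim ≤ 3)
    (hE1 : E.dim = 1) (hEend : Module.finrank ℚ E.endAlgebra = 1) (hTE : ∀ u : T ⟶ E, u = 0)
    {Y : AbelianVariety ℂ} (hY : AbelianVariety.IsIsogenous Y (T.prod E)) : IsStablyNondegenerate Y :=
  (isStablyNondegenerate_prod_nonCMCurve_of_dim_le_three h0 h3 hE1 hEend hTE).of_isIsogenous hY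

/-- **Mixed powers of two factors of total dimension `≤ 3` are stably nondegenerate**: for complex abelian
varieties `B`, `Y` with `0 < dim B`, `0 < dim Y`, `dim B + dim Y ≤ 3`, every `B^{a+1} × Y^{b+1}` satisfies condition (D) —
`B × Y` has dimension `≤ 3` (`isStablyNondegenerate_of_dim_pos_of_dim_le_three`, programmes R19–R21) and (D) passes to
mixed powers (`IsStablyNondegenerate.powSucc_prod_powSucc`). This covers the complementary shapes of the fourfold row:
`X ∼ E × T` with `Hom(T, E) ≠ 0` is `X ∼ E² × S` (`T ∼ E × S`), or `E³ × E'`, or `E⁴` — (D) for EVERY elliptic curve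
`E`, with or without complex multiplication (Moonen–Zarhin Thm. 0.1: the exceptional fourfolds (a)–(c) have pairwise
non-isogenous factor types). [cite: MoonenZarhin1999LowDim, Thm. 0.1 (4) and (5.2)] [cite: vanGeemen1994HodgeAV, §3.6–3.7 (p. 236)] -/
theorem isStablyNondegenerate_powSucc_prod_powSucc_of_dim_add_le_three {B Y : AbelianVariety ℂ} (hB : 0 < B.dim)
    (h3 : B.dim + Y.dim ≤ 3) (a b : ℕ) : IsStablyNondegenerate ((B.powSucc a).prod (Y.powSucc b)) :=
  (isStablyNondegenerate_of_dim_pos_of_dim_le_three (X := B.prod Y) (by rw [dim_prod]; omega)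
    (by rw [dim_prod]; exact h3)).powSucc_prod_powSucc a b

/-- In particular `E^{a+1} × S^{b+1}` for an elliptic curve `E` and an abelian surface `S` (the fourfolds `E² × S`),
and everything isogenous to such a product, satisfy (D) and the Hodge conjecture.
[cite: MoonenZarhin1999LowDim, Thm. 0.1 (4)] [cite: vanGeemen1994HodgeAV, Lemma 3.7] -/
theorem hodgeConjectureFor_of_isIsogenous_curve_powSucc_prod_surface_powSucc (hE1 : E.dim = 1) (hS2 : S.dim = 2)
    (a b : ℕ) {Y : AbelianVariety ℂ} (hY : AbelianVariety.IsIsogenous Y ((E.powSucc a).prod (S.powSucc b))) :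
    HodgeConjectureFor Y.dim Y.X :=
  ((isStablyNondegenerate_powSucc_prod_powSucc_of_dim_add_le_three (B := E) (Y := S) (by omega) (by omega) a b).of_isIsogenous
    hY).hodgeConjectureFor

end StablyNondegenerate

/-! ### §3 THE FOURFOLD THEOREM: every `T × E`, `dim T = 3`, `E` without complex multiplication, satisfies (D) -/

section Fourfold

variable {A B E T Y : AbelianVariety ℂ}

/-- A homomorphism between SIMPLE abelian varieties of different dimensions vanishes (a non-zero one would be an
isogeny, `isIsogeny_of_isSimple_of_ne_zero`, preserving the dimension). [cite: MumfordAV1970, §19 Cor. 2 of Thm. 1 (p. 174)] -/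
theorem hom_eq_zero_of_isSimple_of_dim_ne {X Y : AbelianVariety ℂ} (hX : X.IsSimple) (hY : Y.IsSimple)
    (h : X.dim ≠ Y.dim) (f : X ⟶ Y) : f = 0 := by
  by_contra hf
  exact h (dim_eq_of_isIsogeny (isIsogeny_of_isSimple_of_ne_zero hX hY f hf))

/-- Homomorphisms out of a product vanish when they vanish on both factors (`A × B ≅ A ⊞ B`, `biprod.hom_ext'`).
[cite: MumfordAV1970, §19 (p. 169)] -/
theorem prod_hom_eq_zero_of_forall (h₁ : ∀ f : A ⟶ E, f = 0) (h₂ : ∀ g : B ⟶ E, g = 0) (u : A.prod B ⟶ E) :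
    u = 0 := by
  have h : (biprodIsoProd A B).hom ≫ u = 0 :=
    biprod.hom_ext' _ _ (by rw [comp_zero]; exact h₁ _) (by rw [comp_zero]; exact h₂ _)
  rw [← Category.id_comp u, ← (biprodIsoProd A B).inv_hom_id, Category.assoc, h, comp_zero]

/-- **Products of four elliptic curves, in the shape `(E' × (E₁ × E₂)) × E`, are stably nondegenerate** (multi-curve
slots, van Geemen Thm. 4.3 stably). [cite: vanGeemen1994HodgeAV, Thm. 4.3] [cite: MoonenZarhin1999LowDim, Cor. (3.9)] -/
theorem isStablyNondegenerate_curve_prod_curves_prod_curve {E' E₁ E₂ : AbelianVariety ℂ} (hE' : E'.dim = 1)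
    (h₁ : E₁.dim = 1) (h₂ : E₂.dim = 1) (hE : E.dim = 1) :
    IsStablyNondegenerate ((E'.prod (E₁.prod E₂)).prod E) := by
  obtain ⟨F₁, m₁, g₁, hg₁, hF₁, -⟩ := exists_multiEllSlots_multiPowSucc_card 0 ![E'] (fun _ => 0)
    (fun i => by fin_cases i; simpa using hE')
  obtain ⟨F₂, m₂, g₂, hg₂, hF₂, -⟩ := exists_multiEllSlots_multiPowSucc_card 1 ![E₁, E₂] (fun _ => 0)
    (fun i => by fin_cases i <;> simp [h₁, h₂])
  obtain ⟨F₃, m₃, g₃, hg₃, hF₃, -⟩ := exists_multiEllSlots_multiPowSucc_card 0 ![E] (fun _ => 0)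
    (fun i => by fin_cases i; simpa using hE)
  have h : IsStablyNondegenerate ((E'.prod (E₁.prod E₂)).prod E) :=
    ((hg₁.sum hg₂).sum hg₃).isStablyNondegenerate (fun k => by
        rcases k with (k | k) | k
        · simp only [Sum.elim_inl, hF₁]; fin_cases k; simpa using hE'
        · simp only [Sum.elim_inl, Sum.elim_inr, hF₂]; fin_cases k <;> simp [h₁, h₂]
        · simp only [Sum.elim_inr, hF₃]; fin_cases k; simpa using hE)
      (by change 0 < ((E'.prod (E₁.prod E₂)).prod E).dim; rw [dim_prod, dim_prod, hE']; omega)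
  exact h

/-- **THE FOURFOLD THEOREM (Moonen–Zarhin 1999 Thm. 0.1 (4) for the fourfolds with an elliptic factor WITHOUT complex
multiplication).** For every complex abelian threefold `T` and every elliptic curve `E` with `End⁰(E) = ℚ`, the
fourfold `T × E` is stably nondegenerate (`B• = D•` on all its powers). CASES (Poincaré): `T` simple ⟹ `Hom(T, E) = 0`
(different dimensions) ⟹ the `Hom = 0` row (`isStablyNondegenerate_prod_nonCMCurve_of_dim_le_three`, Lemma (3.4));
`T ∼ E' × S` (`exists_curve_prod_surface_isIsogenous_of_not_isSimple_threefold`): `S` non-simple ⟹ `T × E ∼` a product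
of four elliptic curves (Cor. (3.9)); `S` simple (so `Hom(S, E) = 0`) and `E' ∼ E` ⟹ `T × E ∼ S × E²`, mixed powers of the
threefold `S × E`; `S` simple and `Hom(E', E) = 0` ⟹ `Hom(E' × S, E) = 0` ⟹ the `Hom = 0` row for `(E' × S) × E`. (In
Thm. 0.1 the exceptional fourfolds (a) `E_k × T'` need `E_k` of CM type; (b), (c) have no elliptic factor.)
[cite: MoonenZarhin1999LowDim, Thm. 0.1 (4), Lemma (3.4), Prop. (3.8) and Cor. (3.9)]
[cite: MumfordAV1970, §19 Thm. 1 and Cor. 2 (pp. 173–174)] [cite: vanGeemen1994HodgeAV, Thm. 4.3 and §3.6] -/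
theorem isStablyNondegenerate_threefold_prod_nonCMCurve (hT3 : T.dim = 3) (hE1 : E.dim = 1)
    (hEend : Module.finrank ℚ E.endAlgebra = 1) : IsStablyNondegenerate (T.prod E) := by
  classical
  have hEs : E.IsSimple := isSimple_of_dim_le_one hE1.le
  by_cases hTs : T.IsSimple
  · -- `T` simple: `Hom(T, E) = 0`
    exact isStablyNondegenerate_prod_nonCMCurve_of_dim_le_three (by omega) hT3.le hE1 hEend
      (hom_eq_zero_of_isSimple_of_dim_ne hTs hEs (by omega))
  obtain ⟨E', S, hE'1, hS2, hT⟩ := exists_curve_prod_surface_isIsogenous_of_not_isSimple_threefold hT3 hTs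
  have hX : AbelianVariety.IsIsogenous ((E'.prod S).prod E) (T.prod E) := hT.prod (AbelianVariety.IsIsogenous.refl E)
  by_cases hSs : S.IsSimple
  · have hSE : ∀ g : S ⟶ E, g = 0 := hom_eq_zero_of_isSimple_of_dim_ne hSs hEs (by omega)
    by_cases hE'E : ∀ f : E' ⟶ E, f = 0
    · -- `Hom(E' × S, E) = 0`: the `Hom = 0` row for the threefold `E' × S`
      have h3 : (E'.prod S).dim = 3 := by rw [dim_prod, hE'1, hS2]
      exact (isStablyNondegenerate_prod_nonCMCurve_of_dim_le_three (T := E'.prod S) (by omega) h3.le hE1 hEend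
        (prod_hom_eq_zero_of_forall hE'E hSE)).of_isIsogenous' hX
    · -- `E' ∼ E`: `T × E ∼ S × (E × E)`, mixed powers of the threefold `S × E`
      push Not at hE'E
      obtain ⟨f, hf⟩ := hE'E
      have hE'iso : AbelianVariety.IsIsogenous E' E :=
        ⟨f, isIsogeny_of_isSimple_of_ne_zero (isSimple_of_dim_le_one hE'1.le) hEs f hf⟩
      have hiso : AbelianVariety.IsIsogenous ((E'.prod S).prod E) (S.prod (E.prod E)) :=
        (isIsogenous_prodRotate E' S E).trans
          ((AbelianVariety.IsIsogenous.refl S).prod (hE'iso.prod (AbelianVariety.IsIsogenous.refl E)))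
      have hD : IsStablyNondegenerate (S.prod (E.prod E)) :=
        isStablyNondegenerate_powSucc_prod_powSucc_of_dim_add_le_three (B := S) (Y := E) (by omega) (by omega) 0 1
      exact (hD.of_isIsogenous hiso).of_isIsogenous' hX
  · -- `S ∼ E₁ × E₂`: a product of four elliptic curves
    obtain ⟨E₁, E₂, h₁, h₂, hS⟩ := exists_curve_prod_curve_isIsogenous_of_not_isSimple_surface hS2 hSs
    have hiso : AbelianVariety.IsIsogenous ((E'.prod (E₁.prod E₂)).prod E) ((E'.prod S).prod E) :=
      (((AbelianVariety.IsIsogenous.refl E').prod hS).prod (AbelianVariety.IsIsogenous.refl E))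
    exact ((isStablyNondegenerate_curve_prod_curves_prod_curve hE'1 h₁ h₂ hE1).of_isIsogenous' hiso).of_isIsogenous' hX

/-- `A × B ∼ B × A` (the swap isomorphism through `A × B ≅ A ⊞ B`). [cite: MumfordAV1970, §19 (p. 169)] -/
theorem isIsogenous_prod_swap (A B : AbelianVariety ℂ) : AbelianVariety.IsIsogenous (A.prod B) (B.prod A) := by
  have h1 : AbelianVariety.IsIsogenous (A.prod B) (A ⊞ B) :=
    ⟨(biprodIsoProd A B).inv, isIsogeny_hom_of_iso (biprodIsoProd A B).symm⟩
  have h3 : AbelianVariety.IsIsogenous (B ⊞ A) (B.prod A) :=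
    ⟨(biprodIsoProd B A).hom, isIsogeny_hom_of_iso (biprodIsoProd B A)⟩
  exact (h1.trans (isIsogenous_biprod_comm A B)).trans h3

/-- The same fourfolds in the order `E × T`. [cite: MoonenZarhin1999LowDim, Thm. 0.1 (4) and Lemma (3.4)] -/
theorem isStablyNondegenerate_nonCMCurve_prod_threefold (hT3 : T.dim = 3) (hE1 : E.dim = 1)
    (hEend : Module.finrank ℚ E.endAlgebra = 1) : IsStablyNondegenerate (E.prod T) :=
  (isStablyNondegenerate_threefold_prod_nonCMCurve hT3 hE1 hEend).of_isIsogenous (isIsogenous_prod_swap E T)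

/-- **Every complex abelian variety isogenous to `T × E` (`dim T = 3`, `E` a non-CM elliptic curve) — in particular
every abelian FOURFOLD with an elliptic isogeny factor without complex multiplication — is stably nondegenerate.**
[cite: MoonenZarhin1999LowDim, Thm. 0.1 (4)] [cite: vanGeemen1994HodgeAV, §3.6 (p. 236)] -/
theorem isStablyNondegenerate_of_isIsogenous_threefold_prod_nonCMCurve (hT3 : T.dim = 3) (hE1 : E.dim = 1)
    (hEend : Module.finrank ℚ E.endAlgebra = 1) {X : AbelianVariety ℂ}
    (hX : AbelianVariety.IsIsogenous X (T.prod E)) : IsStablyNondegenerate X :=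
  (isStablyNondegenerate_threefold_prod_nonCMCurve hT3 hE1 hEend).of_isIsogenous hX

/-- **The Hodge conjecture for every power of every abelian variety isogenous to `T × E`** (`dim T = 3`, `E` an
elliptic curve without complex multiplication) — UNCONDITIONALLY (no HC_CM).
[cite: MoonenZarhin1999LowDim, Thm. 0.1 (4)] [cite: vanGeemen1994HodgeAV, Lemma 3.7] -/
theorem hodgeConjectureFor_powSucc_of_isIsogenous_threefold_prod_nonCMCurve (hT3 : T.dim = 3) (hE1 : E.dim = 1)
    (hEend : Module.finrank ℚ E.endAlgebra = 1) {X : AbelianVariety ℂ}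
    (hX : AbelianVariety.IsIsogenous X (T.prod E)) (N : ℕ) :
    HodgeConjectureFor (X.powSucc N).dim (X.powSucc N).X :=
  (isStablyNondegenerate_of_isIsogenous_threefold_prod_nonCMCurve hT3 hE1 hEend hX).hodgeConjectureFor_powSucc N

/-- **The Hodge conjecture for every abelian variety isogenous to `T × E`** (`dim T = 3`, `E` non-CM elliptic).
[cite: MoonenZarhin1999LowDim, Thm. 0.1 (4)] -/
theorem hodgeConjectureFor_of_isIsogenous_threefold_prod_nonCMCurve (hT3 : T.dim = 3) (hE1 : E.dim = 1)
    (hEend : Module.finrank ℚ E.endAlgebra = 1) {X : AbelianVariety ℂ}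
    (hX : AbelianVariety.IsIsogenous X (T.prod E)) : HodgeConjectureFor X.dim X.X :=
  (isStablyNondegenerate_of_isIsogenous_threefold_prod_nonCMCurve hT3 hE1 hEend hX).hodgeConjectureFor

/-- **The Hodge conjecture for the fourfold `T × E` itself.** [cite: MoonenZarhin1999LowDim, Thm. 0.1 (4)] -/
theorem hodgeConjectureFor_threefold_prod_nonCMCurve (hT3 : T.dim = 3) (hE1 : E.dim = 1)
    (hEend : Module.finrank ℚ E.endAlgebra = 1) : HodgeConjectureFor (T.prod E).dim (T.prod E).X :=
  (isStablyNondegenerate_threefold_prod_nonCMCurve hT3 hE1 hEend).hodgeConjectureFor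

end Fourfold

end Literature.AlgebraicGeometry.HodgeTheory

end
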